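import Literature.NumberTheory.FaltingsSerre.CoreCertificate
import Literature.NumberTheory.FaltingsSerre.ResidualImage
import HarnessLib

/-!
# Residual Frobenius data READ OFF Euler factors: `L mod 2`, elements of order `3` and `5`

[BPPTVY] = A. Brumer, A. Pacetti, C. Poor, G. Tornaría, J. Voight, D. S. Yuen, *On the paramodularity of
typical abelian surfaces*, Algebra & Number Theory **13**:5 (2019) 1145–1195 [cite: BrumerEtAl2019].

[§7.3 p. 1191, proof of Thm 7.3.1]: "`Q₃(f,T) = 1 + 4T + 9T² + 12T³ + 9T⁴ ≡ 1 + T² + T⁴ (mod 2)` and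
`Q₁₁(f,T) = 1 + T − T² + 11T³ + 121T⁴ ≡ 1 + T + T² + T³ + T⁴ (mod 2)` … In particular, the residual
image has order divisible by `3` and `5`."  [(5.2.3) p. 1175] uses `Q_p(f,T) mod 2` the same way, and
[Lemma 5.1.5 p. 1173] reads image `S₅(b)` from a transvection and an element of order `5`.

THIS FILE types that move in the kernel, for BOTH sides (anything with `HasFrobCharpolyAt` data of
surface shape — the curve side gets it from `IsFrameOfTateRep` + `HasGoodEulerFactorAt`
[(4.1.5)], the form side has it as the cited input [Thm 4.3.4 (iv)]):
* `map_reverse_lPolynomialOfSurface_mod_two`: for `q` odd, `X⁴L(1/X) ≡ X⁴ + āX³ + b̄X² + āX + 1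
  (mod 2)`; corollaries `…_of_parity` (`a` even, `b` odd ⇒ `X⁴ + X² + 1 = (X²+X+1)²`) and
  `…_of_odd_odd` (`a`, `b` odd ⇒ `Φ₅ = X⁴ + X³ + X² + X + 1`);
* `charpoly_residual` (`charpoly ρ̄(σ) = charpoly ρ(σ) mod ℓ`) and
  `charpoly_residual_of_hasFrobCharpolyAt` — the kernel link from Frobenius-polynomial data to the
  RESIDUAL representation (how Step 1's `Q_p mod 2` / `L_p mod 2` enter);
* `GSp4F2.pow_six_eq_one_of_charpoly` (Cayley–Hamilton over `𝔽₂`: charpoly `X⁴+X²+1` ⇒ `g⁶ = 1`,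
  `g² ≠ 1`), `GSp4F2.trace_sq` (`tr g² = tr g` over `𝔽₂`);
* `exists_orderThree_datum` / `…_of_eulerData`: two representations with `a_q` even, `b_q` odd at one
  odd `q` ⇒ `u := Frob_q²` has `ρ̄(u)³ = 1 ≠ ρ̄(u)` and `tr ρ̄(u) = tr ρ̄'(u)` — exactly the extra
  input of the `S₆` / `S₃ ≀ S₂` residual-rigidity theorems (`ResidualRigidity*.lean`) beyond "same
  kernel field" (it is what excludes the outer automorphism of `S₆`);
* `exists_orderFive` / `…_of_eulerData`: `a_q`, `b_q` odd ⇒ `ρ̄(Frob_q)` has order `5` (via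
  `GSp4F2.pow_five_eq_one_of_charpoly`, `ResidualImage.lean`) — the `c` of the `S₅(b)` route
  (`ConjCertificate.residual_conj_of_transvection`, `isAbsIrreducible_of_transvection_of_charpoly`).
No new cited fact.

## References
* [BPPTVY] (4.1.5) p. 1164; Lemma 5.1.5 p. 1173; (5.1.8) p. 1174; (5.2.3) p. 1175; §7.3 p. 1191. [cite: BrumerEtAl2019]
-/

noncomputable section

namespace Literature.NumberTheory.FaltingsSerre

open Matrix Equiv Field IsDedekindDomain Polynomial
open Literature.NumberTheory.GaloisRepresentations Literature.NumberTheory.FaltingsSerre.GSp4F2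
  Literature.AlgebraicGeometry.Motives
open scoped NumberField

section ModTwo

/-! ## `X⁴L(1/X) mod 2` for a surface-shaped `L` -/

/-- The `T²`-coefficient of `lPolynomialOfSurface q a b` is `b`. [cite: BrumerEtAl2019, (4.1.5) p. 1164] -/
theorem coeff_lPolynomialOfSurface_two (q : ℕ) (a b : ℤ) :
    (lPolynomialOfSurface q a b).coeff 2 = b := by
  simp only [lPolynomialOfSurface, coeff_add, coeff_sub, coeff_one, coeff_C_mul, coeff_X_pow, coeff_X]
  norm_num

/-- The `T³`-coefficient of `lPolynomialOfSurface q a b` is `−qa`. [cite: BrumerEtAl2019, (4.1.5) p. 1164] -/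
theorem coeff_lPolynomialOfSurface_three (q : ℕ) (a b : ℤ) :
    (lPolynomialOfSurface q a b).coeff 3 = -((q : ℤ) * a) := by
  simp only [lPolynomialOfSurface, coeff_add, coeff_sub, coeff_one, coeff_C_mul, coeff_X_pow, coeff_X]
  norm_num

/-- **`X⁴L(1/X) mod 2`.**  For `q` odd, the Frobenius polynomial `X⁴ − aX³ + bX² − qaX + q²` of a
surface-shaped `L = 1 − aT + bT² − qaT³ + q²T⁴` reduces to `X⁴ + āX³ + b̄X² + āX + 1` over `𝔽₂`
(`ā, b̄` = `a, b mod 2`) — the datum "`Q_p(f,T) mod 2`" / "`L_p(A,T) mod 2`" of [BPPTVY, (5.2.3)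
p. 1175; §7.1 p. 1188; §7.3 p. 1191]. [cite: BrumerEtAl2019, (5.2.3) p. 1175 and §7.3 p. 1191] -/
theorem map_reverse_lPolynomialOfSurface_mod_two {q : ℕ} (hq : Odd q) (a b : ℤ) :
    ((lPolynomialOfSurface q a b).reverse.map (Int.castRingHom ℤ_[2])).map (PadicInt.toZMod (p := 2)) =
      X ^ 4 + C ((a : ℤ) : ZMod 2) * X ^ 3 + C ((b : ℤ) : ZMod 2) * X ^ 2 +
        C ((a : ℤ) : ZMod 2) * X + 1 := by
  have hq0 : q ≠ 0 := hq.pos.ne'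
  rw [Polynomial.map_map, show (PadicInt.toZMod (p := 2)).comp (Int.castRingHom ℤ_[2]) =
    Int.castRingHom (ZMod 2) from RingHom.ext_int _ _]
  have hqZ : ((q : ℕ) : ZMod 2) = 1 := (ZMod.natCast_eq_one_iff_odd).2 hq
  have hneg : ∀ x : ZMod 2, -x = x := fun x => ZMod.neg_eq_self_mod_two x
  have hdeg := natDegree_lPolynomialOfSurface hq0 a b
  ext n
  rw [coeff_map, eq_intCast]
  simp only [coeff_add, coeff_C_mul, coeff_X_pow, coeff_X, coeff_one]
  rcases n with _ | _ | _ | _ | _ | n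
  · rw [coeff_reverse, hdeg, revAt_le (by norm_num), show 4 - 0 = 4 from rfl,
      coeff_lPolynomialOfSurface_four]
    push_cast
    simp [hqZ]
  · rw [coeff_reverse, hdeg, revAt_le (by norm_num), show 4 - (0 + 1) = 3 from rfl,
      coeff_lPolynomialOfSurface_three]
    push_cast
    simp [hqZ, hneg]
  · rw [coeff_reverse, hdeg, revAt_le (by norm_num), show 4 - (0 + 1 + 1) = 2 from rfl,
      coeff_lPolynomialOfSurface_two]
    simp
  · rw [coeff_reverse, hdeg, revAt_le (by norm_num), show 4 - (0 + 1 + 1 + 1) = 1 from rfl,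
      coeff_lPolynomialOfSurface_one]
    push_cast
    simp [hneg]
  · rw [coeff_reverse, hdeg, revAt_le (by norm_num), show 4 - (0 + 1 + 1 + 1 + 1) = 0 from rfl,
      lPolynomialOfSurface_coeff_zero]
    simp
  · rw [coeff_eq_zero_of_natDegree_lt (lt_of_le_of_lt
      ((reverse_natDegree_le _).trans (natDegree_lPolynomialOfSurface_le q a b)) (by omega))]
    simp [show n + 1 + 1 + 1 + 1 + 1 ≠ 4 by omega]

/-- `a` even, `b` odd (`q` odd): `X⁴L(1/X) ≡ X⁴ + X² + 1 = (X² + X + 1)² (mod 2)` — "the residual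
image has order divisible by `3`". [cite: BrumerEtAl2019, (5.2.3) p. 1175 and §7.3 p. 1191] -/
theorem map_reverse_lPolynomialOfSurface_of_parity {q : ℕ} (hq : Odd q) {a b : ℤ} (ha : Even a)
    (hb : Odd b) :
    ((lPolynomialOfSurface q a b).reverse.map (Int.castRingHom ℤ_[2])).map (PadicInt.toZMod (p := 2)) =
      X ^ 4 + X ^ 2 + 1 := by
  rw [map_reverse_lPolynomialOfSurface_mod_two hq,
    (ZMod.intCast_zmod_eq_zero_iff_dvd a 2).2 (even_iff_two_dvd.1 ha), (ZMod.intCast_eq_one_iff_odd).2 hb]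
  simp

/-- `a` odd, `b` odd (`q` odd): `X⁴L(1/X) ≡ X⁴ + X³ + X² + X + 1 = Φ₅ (mod 2)` — "the residual image
has order divisible by `5`" (`Q₁₁(f⁻₅₈₇,T) ≡ 1 + T + T² + T³ + T⁴`). [cite: BrumerEtAl2019, §7.3 p. 1191 and Lemma 5.1.5 p. 1173] -/
theorem map_reverse_lPolynomialOfSurface_of_odd_odd {q : ℕ} (hq : Odd q) {a b : ℤ} (ha : Odd a)
    (hb : Odd b) :
    ((lPolynomialOfSurface q a b).reverse.map (Int.castRingHom ℤ_[2])).map (PadicInt.toZMod (p := 2)) =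
      X ^ 4 + X ^ 3 + X ^ 2 + X + 1 := by
  rw [map_reverse_lPolynomialOfSurface_mod_two hq, (ZMod.intCast_eq_one_iff_odd).2 ha,
    (ZMod.intCast_eq_one_iff_odd).2 hb]
  simp

end ModTwo

section Residual

/-! ## The characteristic polynomial of `ρ̄(Frob)` from `HasFrobCharpolyAt` data -/

/-- The characteristic polynomial of `ρ̄(σ)` is the reduction of that of `ρ(σ)`. [cite: BrumerEtAl2019, §2.1 p. 1150] -/
theorem charpoly_residual {Γ : Type*} [Group Γ] {n ℓ : ℕ} [Fact ℓ.Prime] (ρ : Γ →* GL (Fin n) ℤ_[ℓ])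
    (σ : Γ) :
    ((residual ρ σ : GL (Fin n) (ZMod ℓ)) : Matrix (Fin n) (Fin n) (ZMod ℓ)).charpoly =
      ((ρ σ : GL (Fin n) ℤ_[ℓ]) : Matrix (Fin n) (Fin n) ℤ_[ℓ]).charpoly.map (PadicInt.toZMod (p := ℓ)) := by
  rw [residual_apply_coe, Matrix.charpoly_map]

/-- `charpoly ρ̄(σ) = P mod 2` for an arithmetic Frobenius `σ` at `𝔓 ∣ v` when `ρ` has Frobenius
polynomial `P` at `v`. [cite: BrumerEtAl2019, §2.1 p. 1150 and (5.2.3) p. 1175] -/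
theorem charpoly_residual_of_hasFrobCharpolyAt {ρ : FramedGaloisRep ℚ ℤ_[2] 4}
    {v : HeightOneSpectrum (𝓞 ℚ)} {P : ℤ_[2][X]} (h : ρ.HasFrobCharpolyAt v P)
    {𝔓 : Ideal (absIntegers (𝓞 ℚ) ℚ)} (h𝔓 : 𝔓 ∈ v.primesAbove) {σ : absoluteGaloisGroup ℚ}
    (hσ : IsArithFrobAt (𝓞 ℚ) σ 𝔓) :
    ((residual ρ.toMonoidHom σ : GL (Fin 4) (ZMod 2)) : Matrix (Fin 4) (Fin 4) (ZMod 2)).charpoly =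
      P.map (PadicInt.toZMod (p := 2)) := by
  have hc : ((ρ σ : GL (Fin 4) ℤ_[2]) : Matrix (Fin 4) (Fin 4) ℤ_[2]).charpoly = P := h 𝔓 h𝔓 σ hσ
  rw [charpoly_residual, ← hc]
  rfl

/-- An arithmetic Frobenius at a rational prime `q` exists (some place `v ∋ q`, some `𝔓 ∣ v` of `ℚ̄`,
some `σ`). [folklore] -/
theorem exists_arithFrob (q : ℕ) (hq : q.Prime) :
    ∃ v : HeightOneSpectrum (𝓞 ℚ), ∃ 𝔓 ∈ v.primesAbove, ∃ σ : absoluteGaloisGroup ℚ,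
      ((q : ℕ) : 𝓞 ℚ) ∈ v.asIdeal ∧ IsArithFrobAt (𝓞 ℚ) σ 𝔓 := by
  obtain ⟨v, hv⟩ := exists_place_above hq
  obtain ⟨𝔓, h𝔓⟩ := HeightOneSpectrum.primesAbove_nonempty v
  obtain ⟨σ, hσ⟩ := HeightOneSpectrum.exists_isArithFrobAt_of_mem_primesAbove_holds h𝔓
  exact ⟨v, 𝔓, h𝔓, σ, hv, hσ⟩

/-- **Cayley–Hamilton over `𝔽₂`:** a `4 × 4` matrix with characteristic polynomial `X⁴ + X² + 1 =
(X² + X + 1)²` satisfies `g⁶ = 1` and `g² ≠ 1` (so `g²` has order exactly `3`). [folklore] -/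
theorem GSp4F2.pow_six_eq_one_of_charpoly {g : Matrix (Fin 4) (Fin 4) (ZMod 2)}
    (h : g.charpoly = X ^ 4 + X ^ 2 + 1) : g ^ 6 = 1 ∧ g ^ 2 ≠ 1 := by
  have hCH := Matrix.aeval_self_charpoly g
  rw [h] at hCH
  have hCH' : g ^ 4 + g ^ 2 + 1 = 0 := by
    simpa only [map_add, map_pow, aeval_X, map_one] using hCH
  refine ⟨?_, ?_⟩
  · have e : aeval g ((X ^ 2 - 1) * (X ^ 4 + X ^ 2 + 1) : (ZMod 2)[X]) = g ^ 6 - 1 := by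
      rw [show ((X ^ 2 - 1) * (X ^ 4 + X ^ 2 + 1) : (ZMod 2)[X]) = X ^ 6 - 1 by ring]
      simp only [map_sub, map_pow, aeval_X, map_one]
    rw [map_mul, hCH, mul_zero] at e
    exact sub_eq_zero.1 e.symm
  · intro h2
    have h4 : g ^ 4 = 1 := by
      calc g ^ 4 = (g ^ 2) ^ 2 := by rw [← pow_mul]
        _ = 1 := by rw [h2, one_pow]
    rw [h4, h2] at hCH'
    have h00 := congrFun (congrFun hCH' 0) 0
    revert h00
    simp only [Matrix.add_apply, Matrix.one_apply_eq, Matrix.zero_apply]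
    decide

/-- Over `𝔽₂`, `tr(g²) = tr(g)` (`charpoly(g²) = charpoly(g)`). [folklore] -/
theorem GSp4F2.trace_sq (g : Matrix (Fin 4) (Fin 4) (ZMod 2)) :
    Matrix.trace (g ^ 2) = Matrix.trace g := by
  rw [Matrix.trace_eq_neg_charpoly_coeff, Matrix.trace_eq_neg_charpoly_coeff, ZMod.charpoly_pow_card]

/-- **The order-`3` datum from Frobenius polynomials** (two representations, curve or form side).  If
`ρ`, `ρ'` have at the places over one odd prime `q` surface-shaped Frobenius polynomials with `a_q`
even and `b_q` odd on both sides, then `u := Frob_q²` satisfies `ρ̄(u)³ = 1`, `ρ̄(u) ≠ 1`,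
`tr ρ̄(u) = tr ρ̄'(u)` — the input of `exists_conj_of_ker_iff_of_trace_orderThree` (image `S₆`) and
`…_of_range_S3wrS2` beyond "same kernel field" (it excludes the outer automorphism of `S₆`).
[cite: BrumerEtAl2019, (5.1.8) p. 1174, (5.2.3) p. 1175 and §7.3 p. 1191] -/
theorem exists_orderThree_datum {ρ ρ' : FramedGaloisRep ℚ ℤ_[2] 4} {q : ℕ} (hq : q.Prime) (hq2 : q ≠ 2)
    {a c a' c' : ℤ}
    (h : ∀ v : HeightOneSpectrum (𝓞 ℚ), ((q : ℕ) : 𝓞 ℚ) ∈ v.asIdeal →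
      ρ.HasFrobCharpolyAt v ((lPolynomialOfSurface q a c).reverse.map (Int.castRingHom ℤ_[2])))
    (h' : ∀ v : HeightOneSpectrum (𝓞 ℚ), ((q : ℕ) : 𝓞 ℚ) ∈ v.asIdeal →
      ρ'.HasFrobCharpolyAt v ((lPolynomialOfSurface q a' c').reverse.map (Int.castRingHom ℤ_[2])))
    (ha : Even a) (hc : Odd c) (ha' : Even a') (hc' : Odd c') :
    ∃ u : absoluteGaloisGroup ℚ, residual ρ.toMonoidHom u ^ 3 = 1 ∧ residual ρ.toMonoidHom u ≠ 1 ∧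
      Matrix.trace ((residual ρ.toMonoidHom u : GL (Fin 4) (ZMod 2)) :
          Matrix (Fin 4) (Fin 4) (ZMod 2)) =
        Matrix.trace ((residual ρ'.toMonoidHom u : GL (Fin 4) (ZMod 2)) :
          Matrix (Fin 4) (Fin 4) (ZMod 2)) := by
  have hqo : Odd q := hq.odd_of_ne_two hq2
  obtain ⟨v, 𝔓, h𝔓, σ, hv, hσ⟩ := exists_arithFrob q hq
  have hr := charpoly_residual_of_hasFrobCharpolyAt (h v hv) h𝔓 hσ
  have hr' := charpoly_residual_of_hasFrobCharpolyAt (h' v hv) h𝔓 hσ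
  rw [map_reverse_lPolynomialOfSurface_of_parity hqo ha hc] at hr
  rw [map_reverse_lPolynomialOfSurface_of_parity hqo ha' hc'] at hr'
  obtain ⟨h6, h2⟩ := GSp4F2.pow_six_eq_one_of_charpoly hr
  refine ⟨σ ^ 2, ?_, ?_, ?_⟩
  · rw [map_pow, ← pow_mul]
    exact Units.ext (by rw [Units.val_pow_eq_pow_val, Units.val_one]; exact h6)
  · rw [map_pow]
    intro h1
    exact h2 (by rw [← Units.val_pow_eq_pow_val, h1, Units.val_one])
  · rw [map_pow, map_pow, Units.val_pow_eq_pow_val, Units.val_pow_eq_pow_val, GSp4F2.trace_sq,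
      GSp4F2.trace_sq, Matrix.trace_eq_neg_charpoly_coeff, Matrix.trace_eq_neg_charpoly_coeff, hr, hr']

/-- **An element of order `5` in the residual image from a Frobenius polynomial** with `a_q`, `b_q`
odd (`q` odd): `ρ̄(Frob_q)` has characteristic polynomial `Φ₅`, hence order `5`
(`GSp4F2.pow_five_eq_one_of_charpoly`, `ResidualImage.lean`) — the `c` of
`ConjCertificate.residual_conj_of_transvection` / `isAbsIrreducible_of_transvection_of_charpoly`
(image `S₅(b)`). [cite: BrumerEtAl2019, Lemma 5.1.5 p. 1173 and §7.3 p. 1191] -/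
theorem exists_orderFive {ρ : FramedGaloisRep ℚ ℤ_[2] 4} {q : ℕ} (hq : q.Prime) (hq2 : q ≠ 2)
    {a c : ℤ}
    (h : ∀ v : HeightOneSpectrum (𝓞 ℚ), ((q : ℕ) : 𝓞 ℚ) ∈ v.asIdeal →
      ρ.HasFrobCharpolyAt v ((lPolynomialOfSurface q a c).reverse.map (Int.castRingHom ℤ_[2])))
    (ha : Odd a) (hc : Odd c) :
    ∃ u : absoluteGaloisGroup ℚ, residual ρ.toMonoidHom u ^ 5 = 1 ∧ residual ρ.toMonoidHom u ≠ 1 := by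
  obtain ⟨v, 𝔓, h𝔓, σ, hv, hσ⟩ := exists_arithFrob q hq
  have hr := charpoly_residual_of_hasFrobCharpolyAt (h v hv) h𝔓 hσ
  rw [map_reverse_lPolynomialOfSurface_of_odd_odd (hq.odd_of_ne_two hq2) ha hc] at hr
  exact ⟨σ, GSp4F2.pow_five_eq_one_of_charpoly _ hr⟩

variable {A A' : AbelianVariety ℚ} {b : Module.Basis (Fin 4) ℚ_[2] (A.rationalTateModule 2)}
  {b' : Module.Basis (Fin 4) ℚ_[2] (A'.rationalTateModule 2)} {ρ ρ' : FramedGaloisRep ℚ ℤ_[2] 4}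

/-- Curve side: a frame of `T₂A` has the Frobenius polynomials `X⁴L_q(A)(1/X)` at the places over a
good odd `q` [(4.1.3)–(4.1.5)] (`integralForm_of_hasGoodEulerFactorAt`). [cite: BrumerEtAl2019, (4.1.5) p. 1164] -/
theorem hasFrobCharpolyAt_of_eulerData (hframe : A.IsFrameOfTateRep 2 b (rationalize ρ)) {q : ℕ}
    (hq2 : q ≠ 2) {a c : ℤ}
    (hA : A.HasGoodEulerFactorAt q ((lPolynomialOfSurface q a c).map (Int.castRingHom ℚ))) :
    ∀ v : HeightOneSpectrum (𝓞 ℚ), ((q : ℕ) : 𝓞 ℚ) ∈ v.asIdeal →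
      ρ.HasFrobCharpolyAt v ((lPolynomialOfSurface q a c).reverse.map (Int.castRingHom ℤ_[2])) :=
  fun _ hv => (integralForm_of_hasGoodEulerFactorAt hA (Ne.symm hq2) hframe hv).2

/-- **The order-`3` datum from the EULER FACTORS of two surfaces** at one good odd prime with `a_q`
even, `b_q` odd on both sides; for `N = 587`: `q = 3`, `L₃(A⁻) = 1 + 4T + 9T² + 12T³ + 9T⁴`,
`L₃(A⁺) = 1 + T² + 9T⁴`. [cite: BrumerEtAl2019, (5.2.3) p. 1175 and Thm 7.3.1 p. 1191] -/
theorem exists_orderThree_datum_of_eulerData (hframe : A.IsFrameOfTateRep 2 b (rationalize ρ))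
    (hframe' : A'.IsFrameOfTateRep 2 b' (rationalize ρ')) {q : ℕ} (hq : q.Prime) (hq2 : q ≠ 2)
    {a c a' c' : ℤ}
    (hA : A.HasGoodEulerFactorAt q ((lPolynomialOfSurface q a c).map (Int.castRingHom ℚ)))
    (hA' : A'.HasGoodEulerFactorAt q ((lPolynomialOfSurface q a' c').map (Int.castRingHom ℚ)))
    (ha : Even a) (hc : Odd c) (ha' : Even a') (hc' : Odd c') :
    ∃ u : absoluteGaloisGroup ℚ, residual ρ.toMonoidHom u ^ 3 = 1 ∧ residual ρ.toMonoidHom u ≠ 1 ∧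
      Matrix.trace ((residual ρ.toMonoidHom u : GL (Fin 4) (ZMod 2)) :
          Matrix (Fin 4) (Fin 4) (ZMod 2)) =
        Matrix.trace ((residual ρ'.toMonoidHom u : GL (Fin 4) (ZMod 2)) :
          Matrix (Fin 4) (Fin 4) (ZMod 2)) :=
  exists_orderThree_datum hq hq2 (hasFrobCharpolyAt_of_eulerData hframe hq2 hA)
    (hasFrobCharpolyAt_of_eulerData hframe' hq2 hA') ha hc ha' hc'

/-- **An element of order `5` in `im ρ̄_{A,2}` from the Euler factor of `A`** at one good odd prime
with `a_q`, `b_q` odd. [cite: BrumerEtAl2019, Lemma 5.1.5 p. 1173 and §7.1 p. 1188] -/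
theorem exists_orderFive_of_eulerData (hframe : A.IsFrameOfTateRep 2 b (rationalize ρ)) {q : ℕ}
    (hq : q.Prime) (hq2 : q ≠ 2) {a c : ℤ}
    (hA : A.HasGoodEulerFactorAt q ((lPolynomialOfSurface q a c).map (Int.castRingHom ℚ)))
    (ha : Odd a) (hc : Odd c) :
    ∃ u : absoluteGaloisGroup ℚ, residual ρ.toMonoidHom u ^ 5 = 1 ∧ residual ρ.toMonoidHom u ≠ 1 :=
  exists_orderFive hq hq2 (hasFrobCharpolyAt_of_eulerData hframe hq2 hA) ha hc

end Residual

end Literature.NumberTheory.FaltingsSerre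

end
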